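import Literature.Probability.Percolation.SepArmsOnSmallRatio
import Literature.Probability.Percolation.ArmSeparationInExtFour
import Literature.Probability.Percolation.LocallyMonotoneFKG
import HarnessLib

/-!
# Inward extension of the fenced `k`-arm event `sepArmsOn κ s` at constant cost

Topic: Probability / Percolation; family `crit-perc` (critical and near-critical site percolation
on the triangular lattice `𝕋`; hexagonal annuli `Λ_N ∖ Λ_n`). A brick toward the named fact
`Literature.Probability.Percolation.Nolin2008_prop17_quasiMult` (P. Nolin, *Near-critical
percolation in two dimensions*, EJP 13 (2008), §4.5 Prop. 17 [arXiv 0711.4948: Prop. 16]) through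
the pipeline `polyArmProb_quasiMult_of_sepArmsOn_separation` (`SepArmsOnQuasiMult.lean`), whose
input is Nolin's arm-separation theorem (Thm. 11 [arXiv Thm. 10]) for the pattern `(κ, s)`
(`k` arms of colours `κ : Fin k → Bool` landing on the pairwise distinct sides `s : Fin k → Fin 6`).
The internal half of Nolin's proof (§4.4 p. 13, "the reasoning is the same for internal
extremities"; in the tree `exists_real_extFourArmQ_le_mul_sepFourArmG_at` for four arms) runs the
induction on scales `le_mul_of_separationScheme_upto` inward, and two of its three
pattern-independent inputs concern the fully fenced event `sepArmsOn κ s` (`SepArmsOnGlue.lean`):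
the initial estimate at bounded ratio (`pow_le_real_sepArmsOn_smallRatio_at`,
`SepArmsOnSmallRatio.lean`) and the **inward extension at constant cost**, proved here for every
pattern:

* `sepArmsOn_inter_inCorr_subset` — deterministic part (Nolin, Prop. 12 (i) [arXiv Prop. 11] on
  the internal boundary; Kesten 1987, Lemma 2): fenced arms from `∂Λ_m` together with the inward
  corridors `sepInCorrQ m m'` read in the `k` frames are fenced arms from `∂Λ_{m'}`
  (`1100 ≤ m'`, `2m' + 1 ≤ m ≤ 3m'`, `2m ≤ N`; `sepArmGen_inter_sepInCorrQ_subset` arm by arm), the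
  new carriers — old carrier cut to its cone support, plus the rotated corridor — being disjoint
  within a colour (the corridors and the parts of the cone supports inside `Λ̊_m` live in the
  pairwise disjoint half-open sectors, `image_rot_halfSector_disjoint`);
* `real_sepArmsOn_mul_pow_le_inward_at` — `P_p(sepArmsOn κ s m N) · (c^93)^k ≤ P_p(sepArmsOn κ s m' N)`
  from RSW at `p` and `1 - p` (Nolin's Lemma 13 [arXiv Lemma 12],
  `triSitePercolation_locallyMonotone_fkg`, with increasing region the open corridors and
  decreasing region the closed ones; independence of the corridors of one colour,
  `real_biInter_eq_prod_of_pairwise_disjoint`; `le_real_sepInCorrQ_at` for each);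
  `exists_real_sepArmsOn_mul_le_inward` — at `p = 1/2` (`tri_rsw_half_holds`).

Everything here is PROVED; no definition and no named fact is introduced.

## References

* P. Nolin, *Near-critical percolation in two dimensions*, Electron. J. Probab. 13 (2008),
  1562–1623, §4.2 Def. 6–8, §4.3 Prop. 12 (i), Lemma 13, §4.4 (proof of Thm. 11, internal
  extremities, p. 13) [arXiv 0711.4948: Def. 6–8, Prop. 11, Lemma 12, Thm. 10]. [Nolin2008]
* H. Kesten, *Scaling relations for 2D-percolation*, Comm. Math. Phys. 109 (1987), Lemma 2. [Kesten1987]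

Tree: `sepArmsOn`, `sepArmsOnCol`, `sepArmsOn_eq_inter`, `isUpperSet_sepArmsOnCol_true`,
`isLowerSet_sepArmsOnCol_false`, `determinedBy_sepArmsOnCol` (`SepArmsOnGlue.lean`); `sepArmAt`,
`mem_sepArmAt`, `sepOpenArmIn`, `mem_sepOpenArmIn_inter_support`, `sepConeSupport`, `triCone`,
`readFrame`, `IsUpperSet.preimage_readFrame_true/false`, `determinedBy_preimage_readFrame`
(`ArmSeparationFourArm.lean`); `sepOpenArm`, `isUpperSet_sepOpenArm` (`ArmSeparation(Proofs).lean`);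
`sepArmGen_zero`, `sepInCorrQ`, `sepInCorrQFinset`, `sepInCorrQFinset_subset`,
`isUpperSet_sepInCorrQ`, `determinedBy_sepInCorrQ`, `sepArmGen_inter_sepInCorrQ_subset`,
`le_real_sepInCorrQ_at` (`ArmSeparationInMoveFour.lean`, `ArmSeparationInExtFour.lean`);
`image_rot_halfSector_disjoint`, `real_biInter_eq_prod_of_pairwise_disjoint`
(`SepArmsOnSmallRatio.lean`); `triSitePercolation_locallyMonotone_fkg` (`LocallyMonotoneFKG.lean`).
-/

noncomputable section

open MeasureTheory Set

namespace Literature.Probability.Percolation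

open LatticeModels

variable {k : ℕ}

/-! ### Confined fenced arms and cut configurations -/

/-- **A fenced arm confined to `P` is a fenced arm of the configuration cut down to `P`**, and
conversely: `χ ∈ sepOpenArmIn P n N ↔ χ ∩ P ∈ sepOpenArm n N`. [folklore] -/
theorem mem_sepOpenArmIn_iff_inter_mem_sepOpenArm {P : Set (Site 2)} {n N : ℕ} (χ : SiteConfig (Site 2)) :
    χ ∈ sepOpenArmIn P n N ↔ χ ∩ P ∈ sepOpenArm n N := by
  have e : ∀ A : Set (Site 2), A ∩ P ∩ χ = A ∩ (χ ∩ P) := fun A => by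
    rw [Set.inter_assoc, Set.inter_comm P]
  constructor
  · rintro ⟨z, z', u, u', hz, hz', ⟨b, t, hb, ht, p₁, p₂⟩, ⟨b', t', hb', ht', p₃, p₄⟩, p₅⟩
    refine ⟨z, z', u, u', hz, hz', ⟨b, t, hb, ht, ?_, ?_⟩, ⟨b', t', hb', ht', ?_, ?_⟩, ?_⟩
    · rw [← e]; exact p₁
    · rw [← e]; exact p₂
    · rw [← e]; exact p₃
    · rw [← e]; exact p₄
    · rw [← e]; exact p₅
  · rintro ⟨z, z', u, u', hz, hz', ⟨b, t, hb, ht, p₁, p₂⟩, ⟨b', t', hb', ht', p₃, p₄⟩, p₅⟩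
    refine ⟨z, z', u, u', hz, hz', ⟨b, t, hb, ht, ?_, ?_⟩, ⟨b', t', hb', ht', ?_, ?_⟩, ?_⟩
    · rw [e]; exact p₁
    · rw [e]; exact p₂
    · rw [e]; exact p₃
    · rw [e]; exact p₄
    · rw [e]; exact p₅

/-! ### Inward extension: the deterministic part -/

/-- A site of the inward corridor `sepInCorrQ m m'` and a site of the cone support
`sepConeSupport m N`, rotated to different sides, differ: both lie inside `Λ̊_m`, hence in the
half-open sector of their side (`64 ≤ m'`, `2m' + 1 ≤ m ≤ 3m'`, `2200 ≤ m`). [folklore] -/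
theorem rot_coneSupport_rot_inCorr_disjoint {a b : ℕ} (ha : a < 6) (hb : b < 6) (hab : a ≠ b) {m m' N : ℕ}
    (hm' : 64 ≤ m') (hmm' : 2 * m' + 1 ≤ m) (hm3 : m ≤ 3 * m') (hm : 2200 ≤ m) :
    Disjoint (triRotIsoPow a '' sepConeSupport m N) (triRotIsoPow b '' ↑(sepInCorrQFinset m m')) := by
  rw [Set.disjoint_left]
  rintro w ⟨u, hu, rfl⟩ ⟨v, hv, huv⟩
  have hv' := sepInCorrQFinset_subset hm' hmm' hm3 hm (Finset.mem_coe.1 hv)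
  have hnw : triNorm (triRotIsoPow a u) = triNorm v := by rw [← huv, triNorm_rot]
  rw [triNorm_rot] at hnw
  rw [mem_sepConeSupport] at hu
  have hc := hu.2.2 (Or.inl (by rw [hnw]; exact hv'.1))
  exact Set.disjoint_left.1 (image_rot_halfSector_disjoint ha hb hab) ⟨u, ⟨hc.2.1.le, hc.2.2⟩, rfl⟩
    ⟨v, ⟨hv'.2.1.le, hv'.2.2⟩, huv⟩

/-- Two inward corridors rotated to different sides are disjoint. [folklore] -/
theorem rot_inCorr_rot_inCorr_disjoint {a b : ℕ} (ha : a < 6) (hb : b < 6) (hab : a ≠ b) {m m' : ℕ}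
    (hm' : 64 ≤ m') (hmm' : 2 * m' + 1 ≤ m) (hm3 : m ≤ 3 * m') (hm : 2200 ≤ m) :
    Disjoint (triRotIsoPow a '' (↑(sepInCorrQFinset m m') : Set (Site 2))) (triRotIsoPow b '' ↑(sepInCorrQFinset m m')) := by
  refine Disjoint.mono ?_ ?_ (image_rot_halfSector_disjoint ha hb hab)
  · rintro w ⟨v, hv, rfl⟩
    have h := sepInCorrQFinset_subset hm' hmm' hm3 hm (Finset.mem_coe.1 hv)
    exact ⟨v, ⟨h.2.1.le, h.2.2⟩, rfl⟩
  · rintro w ⟨v, hv, rfl⟩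
    have h := sepInCorrQFinset_subset hm' hmm' hm3 hm (Finset.mem_coe.1 hv)
    exact ⟨v, ⟨h.2.1.le, h.2.2⟩, rfl⟩

/-- **Inward extension of fenced arms, deterministic part** (Nolin 2008, Prop. 12 (i)
[arXiv 0711.4948: Prop. 11] on the internal boundary; Kesten 1987, Lemma 2): for `1100 ≤ m'`,
`2m' + 1 ≤ m ≤ 3m'`, `2m ≤ N`, fenced arms from `∂Λ_m` on the sides `s` whose `k` frames carry the
inward corridor `sepInCorrQ m m'` in their colour are fenced arms from `∂Λ_{m'}`
(`sepArmGen_inter_sepInCorrQ_subset` arm by arm; new carriers: the old one cut to its cone support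
plus the rotated corridor, pairwise disjoint within a colour). [cite: Nolin2008, §4.3 Prop. 12 (i) and §4.4 p. 13 (arXiv 0711.4948: Prop. 11; proof of Thm. 10, internal extremities)] -/
theorem sepArmsOn_inter_inCorr_subset (κ : Fin k → Bool) (s : Fin k → Fin 6) (hs : Function.Injective s)
    {m m' N : ℕ} (hm' : 1100 ≤ m') (hmm' : 2 * m' + 1 ≤ m) (hm3 : m ≤ 3 * m') (hN : 2 * m ≤ N) :
    sepArmsOn κ s m N ∩ (⋂ j : Fin k, readFrame (s j).val (κ j) ⁻¹' sepInCorrQ m m') ⊆ sepArmsOn κ s m' N := by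
  rintro ω ⟨⟨X, hX, hA⟩, hC⟩
  have hm : 2200 ≤ m := by omega
  have h4 : 4 ≤ m := by omega
  have hmN : m ≤ N := by omega
  set C : Set (Site 2) := ↑(sepInCorrQFinset m m') with hCdef
  refine ⟨fun j => (X j ∩ triRotIsoPow (s j).val '' sepConeSupport m N) ∪ triRotIsoPow (s j).val '' C,
    fun i j hij hκ => ?_, fun j => ?_⟩
  · have hsij : (s i).val ≠ (s j).val := fun e => hij (hs (Fin.ext e))
    refine Disjoint.union_left (Disjoint.union_right ?_ ?_) (Disjoint.union_right ?_ ?_)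
    · exact Disjoint.mono inter_subset_left inter_subset_left (hX i j hij hκ)
    · exact Disjoint.mono inter_subset_right Subset.rfl
        (rot_coneSupport_rot_inCorr_disjoint (s i).2 (s j).2 hsij (by omega) hmm' hm3 hm)
    · exact (Disjoint.mono inter_subset_right Subset.rfl
        (rot_coneSupport_rot_inCorr_disjoint (s j).2 (s i).2 hsij.symm (by omega) hmm' hm3 hm)).symm
    · exact rot_inCorr_rot_inCorr_disjoint (s i).2 (s j).2 hsij (by omega) hmm' hm3 hm
  · dsimp only
    set χ := readFrame (s j).val (κ j) ω with hχ
    set ρj := triRotIsoPow (s j).val with hρj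
    have hinj : Function.Injective ρj := (triRotIsoPow (s j).val).injective
    have eP : ρj ⁻¹' ((X j ∩ ρj '' sepConeSupport m N) ∪ ρj '' C) = (ρj ⁻¹' (X j) ∩ sepConeSupport m N) ∪ C := by
      rw [Set.preimage_union, Set.preimage_inter, Set.preimage_image_eq _ hinj, Set.preimage_image_eq _ hinj]
    rw [mem_sepArmAt, eP]
    -- the old arm, cut to its cone support, inside the bigger cut configuration
    have h0 : χ ∈ sepOpenArmIn (ρj ⁻¹' (X j)) m N := by
      have h := hA j
      rw [mem_sepArmAt] at h
      exact h
    have h1 : χ ∩ (ρj ⁻¹' (X j) ∩ sepConeSupport m N) ∈ sepOpenArm m N :=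
      (mem_sepOpenArmIn_iff_inter_mem_sepOpenArm χ).1 (mem_sepOpenArmIn_inter_support h4 hmN h0)
    have h2 : χ ∩ ((ρj ⁻¹' (X j) ∩ sepConeSupport m N) ∪ C) ∈ sepOpenArm m N :=
      isUpperSet_sepOpenArm m N (Set.inter_subset_inter_right _ subset_union_left) h1
    -- the corridor is unchanged by the cut
    have h3 : χ ∩ ((ρj ⁻¹' (X j) ∩ sepConeSupport m N) ∪ C) ∈ sepInCorrQ m m' := by
      have hχC : χ ∈ sepInCorrQ m m' := Set.mem_iInter.1 hC j
      refine ((determinedBy_iff _ _).1 (determinedBy_sepInCorrQ m m') χ _ ?_).1 hχC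
      ext v
      simp only [mem_inter_iff, mem_union]
      constructor
      · rintro ⟨hv, hvC⟩; exact ⟨⟨hv, Or.inr hvC⟩, hvC⟩
      · rintro ⟨⟨hv, -⟩, hvC⟩; exact ⟨hv, hvC⟩
    have h4' : χ ∩ ((ρj ⁻¹' (X j) ∩ sepConeSupport m N) ∪ C) ∈ sepOpenArm m' N := by
      rw [← sepArmGen_zero] at h2 ⊢
      exact sepArmGen_inter_sepInCorrQ_subset hm' hmm' hm3 hN ⟨h2, h3⟩
    exact (mem_sepOpenArmIn_iff_inter_mem_sepOpenArm χ).2 h4'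

/-! ### Inward extension at constant cost -/

/-- **Inward extension of the fenced `k`-arm event at constant cost, at `p`** (Nolin 2008, proof of
Thm. 11, internal extremities, §4.4 p. 13; Prop. 12 (i), Lemma 13): with the RSW input at `p` and
`1 - p` (aspect ratio `ρ ≥ 256`, heights `≤ Ncap`),
`P_p(sepArmsOn κ s m N) · (c^93)^k ≤ P_p(sepArmsOn κ s m' N)` for `1100 ≤ m'`, `2m' + 1 ≤ m ≤ 3m'`,
`2m ≤ N`, `m ≤ Ncap`. Proof: the generalised FKG inequality `triSitePercolation_locallyMonotone_fkg`
with `A⁺ =` the open half `sepArmsOnCol κ s true m N`, `A⁻ =` the closed half (supports in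
`Λ_{N + N/8}`, off the corridors of the other colour), `B⁺ =` the open corridors, `B⁻ =` the closed
corridors (supports: the rotated corridors, pairwise disjoint), then the deterministic extension
`sepArmsOn_inter_inCorr_subset`; the corridors of one colour are independent, each of probability
`≥ c^93` at `p` or `1 - p` (`le_real_sepInCorrQ_at`). [cite: Nolin2008, §4.3 Prop. 12 (i), Lemma 13 and §4.4 p. 13 (arXiv 0711.4948: Prop. 11, Lemma 12; proof of Thm. 10)] -/
theorem real_sepArmsOn_mul_pow_le_inward_at (κ : Fin k → Bool) (s : Fin k → Fin 6)
    (hs : Function.Injective s) (p : unitInterval) {c : ℝ} {ρ Ncap : ℕ}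
    (hrsw : ∀ q : unitInterval, (q = p ∨ q = unitInterval.symm p) →
      ∀ n : ℕ, 1 ≤ ⌊(ρ : ℝ) * n⌋₊ → n ≤ Ncap → c ≤ triLRCrossingProb q ⌊(ρ : ℝ) * n⌋₊ n)
    (hρ : 256 ≤ ρ) (hc : 0 ≤ c) {m m' N : ℕ} (hm' : 1100 ≤ m') (hmm' : 2 * m' + 1 ≤ m) (hm3 : m ≤ 3 * m')
    (hN : 2 * m ≤ N) (hcap : m ≤ Ncap) :
    (triSitePercolation p).real (sepArmsOn κ s m N) * (c ^ 93) ^ k ≤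
      (triSitePercolation p).real (sepArmsOn κ s m' N) := by
  classical
  have hm : 2200 ≤ m := by omega
  have h4 : 4 ≤ m := by omega
  have hmN : m ≤ N := by omega
  set CF : Finset (Site 2) := sepInCorrQFinset m m' with hCF
  set corr : Set (SiteConfig (Site 2)) := sepInCorrQ m m' with hcorr
  -- the four events
  set Ap := sepArmsOnCol κ s true m N with hAp
  set Am := sepArmsOnCol κ s false m N with hAm
  set E : Fin k → Set (SiteConfig (Site 2)) := fun j => readFrame (s j).val (κ j) ⁻¹' corr with hE
  set tT : Finset (Fin k) := Finset.univ.filter fun j => κ j = true with htT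
  set tF : Finset (Fin k) := Finset.univ.filter fun j => κ j = false with htF
  set Bp : Set (SiteConfig (Site 2)) := ⋂ j ∈ tT, E j with hBp
  set Bm : Set (SiteConfig (Site 2)) := ⋂ j ∈ tF, E j with hBm
  -- the finite sets of sites
  set G : Fin k → Finset (Site 2) := fun j => CF.image (triRotIsoPow (s j).val) with hG
  set PP : Finset (Site 2) := tT.biUnion G with hPP
  set MM : Finset (Site 2) := tF.biUnion G with hMM
  set S : Finset (Site 2) := triBall (N + N / 8) \ (PP ∪ MM) with hS
  have hGcoe : ∀ j, (↑(G j) : Set (Site 2)) = triRotIsoPow (s j).val '' ↑CF := fun j => by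
    rw [hG]; dsimp only; rw [Finset.coe_image]
  -- disjointness of the rotated corridors
  have disjG : ∀ i j : Fin k, i ≠ j → Disjoint (G i) (G j) := by
    intro i j hij
    have hsij : (s i).val ≠ (s j).val := fun e => hij (hs (Fin.ext e))
    rw [← Finset.disjoint_coe, hGcoe, hGcoe]
    exact rot_inCorr_rot_inCorr_disjoint (s i).2 (s j).2 hsij (by omega) hmm' hm3 hm
  have hPM : Disjoint PP MM := by
    rw [hPP, hMM, Finset.disjoint_biUnion_left]
    intro i hi
    rw [Finset.disjoint_biUnion_right]
    intro j hj
    refine disjG i j fun e => ?_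
    rw [htT, Finset.mem_filter] at hi
    rw [htF, Finset.mem_filter] at hj
    rw [e] at hi
    rw [hi.2] at hj
    exact Bool.noConfusion hj.2
  have hSP : Disjoint S PP := by
    rw [hS]; exact Finset.disjoint_of_subset_right Finset.subset_union_left Finset.sdiff_disjoint
  have hSM : Disjoint S MM := by
    rw [hS]; exact Finset.disjoint_of_subset_right Finset.subset_union_right Finset.sdiff_disjoint
  -- the cone supports lie in `Λ_{N + N/8}` and off the corridors of the other colour
  have cone_ball : ∀ j : Fin k, triRotIsoPow (s j).val '' sepConeSupport m N ⊆ ↑(triBall (N + N / 8)) := by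
    rintro j w ⟨v, hv, rfl⟩
    rw [Finset.mem_coe, mem_triBall_iff, triNorm_rot]
    rw [mem_sepConeSupport] at hv
    have := hv.2.1
    omega
  have cone_off : ∀ i j : Fin k, κ i ≠ κ j → Disjoint (triRotIsoPow (s i).val '' sepConeSupport m N) ↑(G j) := by
    intro i j hκ
    have hij : i ≠ j := fun e => hκ (e ▸ rfl)
    have hsij : (s i).val ≠ (s j).val := fun e => hij (hs (Fin.ext e))
    rw [hGcoe]
    exact rot_coneSupport_rot_inCorr_disjoint (s i).2 (s j).2 hsij (by omega) hmm' hm3 hm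
  have suppT : ∀ j : Fin k, κ j = true → triRotIsoPow (s j).val '' sepConeSupport m N ⊆ (↑S ∪ ↑PP : Set (Site 2)) := by
    intro j hj w hw
    by_cases hwP : w ∈ PP
    · exact Or.inr hwP
    · refine Or.inl ?_
      rw [hS, Finset.coe_sdiff, Finset.coe_union]
      refine ⟨cone_ball j hw, fun h => ?_⟩
      rcases h with h | h
      · exact hwP h
      · rw [hMM, Finset.coe_biUnion] at h
        obtain ⟨i, hi, hwi⟩ := Set.mem_iUnion₂.1 h
        rw [Finset.mem_coe, htF, Finset.mem_filter] at hi
        have hκ : κ j ≠ κ i := by rw [hj, hi.2]; decide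
        exact Set.disjoint_left.1 (cone_off j i hκ) hw hwi
  have suppF : ∀ j : Fin k, κ j = false → triRotIsoPow (s j).val '' sepConeSupport m N ⊆ (↑S ∪ ↑MM : Set (Site 2)) := by
    intro j hj w hw
    by_cases hwM : w ∈ MM
    · exact Or.inr hwM
    · refine Or.inl ?_
      rw [hS, Finset.coe_sdiff, Finset.coe_union]
      refine ⟨cone_ball j hw, fun h => ?_⟩
      rcases h with h | h
      · rw [hPP, Finset.coe_biUnion] at h
        obtain ⟨i, hi, hwi⟩ := Set.mem_iUnion₂.1 h
        rw [Finset.mem_coe, htT, Finset.mem_filter] at hi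
        have hκ : κ j ≠ κ i := by rw [hj, hi.2]; decide
        exact Set.disjoint_left.1 (cone_off j i hκ) hw hwi
      · exact hwM h
  -- locality and monotonicity of the four events
  have dAp : DeterminedBy Ap (↑S ∪ ↑PP) := determinedBy_sepArmsOnCol κ s true h4 hmN suppT
  have dAm : DeterminedBy Am (↑S ∪ ↑MM) := determinedBy_sepArmsOnCol κ s false h4 hmN suppF
  have dE : ∀ j, DeterminedBy (E j) ↑(G j) := fun j => by
    rw [hGcoe]; exact determinedBy_preimage_readFrame _ _ (determinedBy_sepInCorrQ m m')
  have dBp : DeterminedBy Bp ↑PP := by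
    rw [hBp, hPP, Finset.coe_biUnion]
    refine DeterminedBy.iInter fun j => DeterminedBy.iInter fun hj => (dE j).mono ?_
    exact Set.subset_iUnion₂ (s := fun i (_ : i ∈ tT) => (↑(G i) : Set (Site 2))) j hj
  have dBm : DeterminedBy Bm ↑MM := by
    rw [hBm, hMM, Finset.coe_biUnion]
    refine DeterminedBy.iInter fun j => DeterminedBy.iInter fun hj => (dE j).mono ?_
    exact Set.subset_iUnion₂ (s := fun i (_ : i ∈ tF) => (↑(G i) : Set (Site 2))) j hj
  have uAp : IsUpperSet Ap := isUpperSet_sepArmsOnCol_true κ s m N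
  have lAm : IsLowerSet Am := isLowerSet_sepArmsOnCol_false κ s m N
  have uBp : IsUpperSet Bp := by
    refine isUpperSet_iInter₂ fun j hj => ?_
    rw [htT, Finset.mem_filter] at hj
    rw [hE]; dsimp only; rw [hj.2]
    exact IsUpperSet.preimage_readFrame_true _ (isUpperSet_sepInCorrQ m m')
  have lBm : IsLowerSet Bm := by
    refine isLowerSet_iInter₂ fun j hj => ?_
    rw [htF, Finset.mem_filter] at hj
    rw [hE]; dsimp only; rw [hj.2]
    exact IsUpperSet.preimage_readFrame_false _ (isUpperSet_sepInCorrQ m m')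
  -- Nolin's Lemma 13
  have fkg := triSitePercolation_locallyMonotone_fkg p hSP hSM hPM uAp lAm uBp lBm dAp dAm dBp dBm
  -- the corridors: independence within a colour, RSW for each
  have hone : ∀ j, c ^ 93 ≤ (triSitePercolation p).real (E j) := by
    intro j
    rw [hE]; dsimp only
    cases κ j
    · have e : readFrame (s j).val false ⁻¹' corr = compl ⁻¹' (rotConfig (s j).val ⁻¹' corr) := by
        ext ω; simp only [mem_preimage, readFrame_false]
      rw [e]
      unfold triSitePercolation
      rw [sitePercolation_real_preimage_compl]
      have h := real_preimage_rotConfig (unitInterval.symm p) (s j).val corr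
      unfold triSitePercolation at h
      rw [h]
      exact le_real_sepInCorrQ_at _ (hrsw _ (Or.inr rfl)) hρ hc hm' hmm' hm3 hcap
    · have e : readFrame (s j).val true ⁻¹' corr = rotConfig (s j).val ⁻¹' corr := by
        ext ω; simp only [mem_preimage, readFrame_true]
      rw [e, real_preimage_rotConfig]
      exact le_real_sepInCorrQ_at _ (hrsw _ (Or.inl rfl)) hρ hc hm' hmm' hm3 hcap
  have prodT := real_biInter_eq_prod_of_pairwise_disjoint p tT E G (fun j _ => dE j) (fun i _ j _ hij => disjG i j hij)
  have prodF := real_biInter_eq_prod_of_pairwise_disjoint p tF E G (fun j _ => dE j) (fun i _ j _ hij => disjG i j hij)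
  have hc93 : 0 ≤ c ^ 93 := pow_nonneg hc _
  have hBp_ge : (c ^ 93) ^ tT.card ≤ (triSitePercolation p).real Bp := by
    rw [hBp, prodT, ← Finset.prod_const]
    exact Finset.prod_le_prod (fun _ _ => hc93) fun j _ => hone j
  have hBm_ge : (c ^ 93) ^ tF.card ≤ (triSitePercolation p).real Bm := by
    rw [hBm, prodF, ← Finset.prod_const]
    exact Finset.prod_le_prod (fun _ _ => hc93) fun j _ => hone j
  have hcard : tT.card + tF.card = k := by
    rw [htT, htF]
    have h := Finset.card_filter_add_card_filter_not (s := (Finset.univ : Finset (Fin k))) (p := fun j => κ j = true)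
    have e : (Finset.univ.filter fun j => ¬ κ j = true) = Finset.univ.filter fun j : Fin k => κ j = false := by
      ext j; simp
    rw [e, Finset.card_univ, Fintype.card_fin] at h
    exact h
  -- the inclusions
  have hA : sepArmsOn κ s m N = Ap ∩ Am := sepArmsOn_eq_inter κ s m N
  have hB : Bp ∩ Bm ⊆ ⋂ j : Fin k, E j := by
    rintro ω ⟨hT, hF⟩
    refine Set.mem_iInter.2 fun j => ?_
    cases hj : κ j
    · exact Set.mem_iInter₂.1 hF j (by rw [htF, Finset.mem_filter]; exact ⟨Finset.mem_univ _, hj⟩)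
    · exact Set.mem_iInter₂.1 hT j (by rw [htT, Finset.mem_filter]; exact ⟨Finset.mem_univ _, hj⟩)
  have hsub : Ap ∩ Am ∩ (Bp ∩ Bm) ⊆ sepArmsOn κ s m' N := by
    rintro ω ⟨hAω, hBω⟩
    rw [← hA] at hAω
    exact sepArmsOn_inter_inCorr_subset κ s hs hm' hmm' hm3 hN ⟨hAω, hB hBω⟩
  calc (triSitePercolation p).real (sepArmsOn κ s m N) * (c ^ 93) ^ k
      = (triSitePercolation p).real (Ap ∩ Am) * ((c ^ 93) ^ tT.card * (c ^ 93) ^ tF.card) := by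
        rw [hA, ← pow_add, hcard]
    _ ≤ (triSitePercolation p).real (Ap ∩ Am) *
          ((triSitePercolation p).real Bp * (triSitePercolation p).real Bm) :=
        mul_le_mul_of_nonneg_left (mul_le_mul hBp_ge hBm_ge (by positivity) measureReal_nonneg) measureReal_nonneg
    _ ≤ (triSitePercolation p).real (Ap ∩ Am ∩ (Bp ∩ Bm)) := fkg
    _ ≤ (triSitePercolation p).real (sepArmsOn κ s m' N) := measureReal_mono hsub (measure_ne_top _ _)

/-- **Inward extension at constant cost, at criticality**: there is `c₁ > 0` with
`P_{1/2}(sepArmsOn κ s m N) · c₁ ≤ P_{1/2}(sepArmsOn κ s m' N)` for `1100 ≤ m'`,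
`2m' + 1 ≤ m ≤ 3m'`, `2m ≤ N` (`tri_rsw_half_holds` at aspect ratio `256`). [cite: Nolin2008, §4.3 Prop. 12 (i) and §4.4 p. 13 (arXiv 0711.4948: Prop. 11; proof of Thm. 10, internal extremities)] -/
theorem exists_real_sepArmsOn_mul_le_inward (κ : Fin k → Bool) (s : Fin k → Fin 6)
    (hs : Function.Injective s) :
    ∃ c₁ : ℝ, 0 < c₁ ∧ ∀ m m' N : ℕ, 1100 ≤ m' → 2 * m' + 1 ≤ m → m ≤ 3 * m' → 2 * m ≤ N →
      (triSitePercolation half).real (sepArmsOn κ s m N) * c₁ ≤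
        (triSitePercolation half).real (sepArmsOn κ s m' N) := by
  obtain ⟨c, hc, h⟩ := tri_rsw_half_holds ((256 : ℕ) : ℝ) (by norm_num)
  refine ⟨(c ^ 93) ^ k, by positivity, fun m m' N hm' hmm' hm3 hN => ?_⟩
  refine real_sepArmsOn_mul_pow_le_inward_at κ s hs half (ρ := 256) (Ncap := m) ?_ le_rfl hc.le hm' hmm' hm3 hN le_rfl
  intro q hq n hn _
  have hq' : q = half := by
    rcases hq with rfl | rfl
    · rfl
    · exact symm_half
  rw [hq']
  exact (h n hn).1

end Literature.Probability.Percolation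

end
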